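import Summits.QuantumFields.BalabanUV.T4Continuum.Support.NE7HintUnconditionalGeneric
import Summits.QuantumFields.BalabanUV.T4Continuum.Support.NE7InteriorMinimiserDocking
import HarnessLib

/-!
# NE7InteriorExistsGeneric — PORT MAP P3.2: (H∃)ᴱ FOR EVERY UNITARY GAUGE GROUP `U(n)` AND EVERY BLOCK SIZE `L ≥ 2`, `d = 4`, NO DISPLAYED HYPOTHESIS — `NE7InteriorExistsSU2.interior_exists_SU2`
# (gen 105, `card n = 2`, `L = 2`) RE-ISSUED GENERICALLY: P2.6 `hint_unconditional_generic` ((8)∃) + the generic docking `NE7InteriorMinimiserDocking.hminE_of_interior_exists_d4`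
# (interior ⟹ `Regular`), with the line `2·10⁹·√(card n)·L⁶·ε ≤ 1` folded into `ε₀`

Cell `pub-balaban`, rung (B)+1 sub-cell t4, lineage `b2b-balaban-t4-ne7-p1`, generation 109 (CRUX PROVER NE7 #1 = OWNER of BINDER row NE7).  Memo
`t4/b2b-balaban-t4-ne7-p1-g109/ROAD-G109.md` §3 (PORT MAP item P3.2).
WHAT ([folklore]; 0 def, 0 sorry).  **`interior_exists_generic`**: for every `L ≥ 2`: `∃ ℓ ≥ 1, ∃ ε₀ > 0, ∀ 0 < ε ≤ ε₀, ∃ β₀ > 0, ∀ 0 < β ≤ β₀, ∀ N ≥ 1, ∃ δ_V > 0` such that for every unitary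
`N`-periodic `V` with `SmallField V δ_V` and every level `k` SOME constrained Wilson minimiser at level `k` over `V` is `Regular 4 L N ε g(ε, L, card n) k` (the explicit energy-class letter
of (H∀)ᴱ, with `L²` in place of the record's `2²`).
HONEST FRAMING (page 1): composition of landed kernel theorems; nothing of Bałaban's asserted; constants existential; NOT NE7, NOT NE3; spine count unchanged; finite T⁴ rung (B)+1 — NOT infinite
volume, NOT mass gap, NOT BetaPertH, NOT Clay (continuum YM on T⁴ ⇐ BetaPertH ∧ nine spine estimates).
-/

set_option autoImplicit false

open scoped BigOperators Matrix Matrix.Norms.L2Operator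
open NormedSpace Finset Set

namespace Summit.QuantumFields.BalabanUV.T4Continuum.NE7InteriorExistsGeneric

open Literature.MathematicalPhysics.QuantumFieldTheory.Balaban1983to89
open B7Prop1Explicit B7Prop2Explicit
open T4AveragingDeficitWall (IsUnitaryCfg SmallField)
open T4AveragingDeficitWallBoundary (IsPeriodicCfg)
open MinimalActionSandwich (IsMinimiser)
open MinimalActionRate (Regular sfClass)
open NE7HintUnconditionalGeneric (hint_unconditional_generic)
open NE7InteriorMinimiserDocking (hminE_of_interior_exists_d4)

noncomputable section

variable {n : Type} [Fintype n] [DecidableEq n]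

/-- **(H∃)ᴱ FOR EVERY `U(n)` AND EVERY `L ≥ 2`, `d = 4` — NO DISPLAYED HYPOTHESIS** (statement in the file header). [folklore] -/
theorem interior_exists_generic [Nonempty n] {L : ℕ} (hL : 2 ≤ L) :
    ∃ ℓ : ℕ, 1 ≤ ℓ ∧ ∃ ε₀ : ℝ, 0 < ε₀ ∧ ∀ ε : ℝ, 0 < ε → ε ≤ ε₀ → ∃ β₀ : ℝ, 0 < β₀ ∧ ∀ β : ℝ, 0 < β → β ≤ β₀ →
    ∀ (N : ℕ) [NeZero N], 1 ≤ N →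
    ∃ δV : ℝ, 0 < δV ∧
      ∀ V ∈ {V : Site 4 → Fin 4 → (Matrix n n ℂ)ˣ | IsUnitaryCfg V ∧ IsPeriodicCfg V (N : ℤ) ∧ SmallField V δV},
      ∀ k : ℕ, ∃ U : Site 4 → Fin 4 → (Matrix n n ℂ)ˣ, IsMinimiser 4 (sfClass 4 L N ε) L N k V U ∧
        Regular 4 L N ε ((Fintype.card n : ℝ)
            * (624 * ((4 : ℕ) : ℝ) ^ 3 * ε ^ 2 * (1 + (((4 : ℕ) : ℝ) + 1) * ε) ^ 2
                + 6768 * (Fintype.card (T4AveragingDeficitWall.Plane 4) : ℝ) ^ 2 * (4 : ℕ) * Fintype.card n * ε ^ 4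
                + 16 * ((4 : ℕ) : ℝ) ^ 3 * ε ^ 2 * (L : ℝ) ^ 2)
          + 220 * (Fintype.card n : ℝ) * ((4 : ℕ) : ℝ) ^ 3 * ε ^ 3) k U := by
  have hL0 : (0 : ℝ) < L := by exact_mod_cast (show 0 < L by omega)
  obtain ⟨ℓ, hℓ1, ε₀, hε₀, H⟩ := hint_unconditional_generic (n := n) hL
  have hc0 : 0 < 2 * 10 ^ 9 * Real.sqrt (Fintype.card n) * (L : ℝ) ^ 6 := by
    have : 0 < Real.sqrt (Fintype.card n : ℝ) := Real.sqrt_pos.2 (by exact_mod_cast Fintype.card_pos)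
    positivity
  refine ⟨ℓ, hℓ1, min ε₀ (1 / (2 * 10 ^ 9 * Real.sqrt (Fintype.card n) * (L : ℝ) ^ 6)), lt_min hε₀ (by positivity), fun ε hε hεle => ?_⟩
  obtain ⟨β₀, hβ₀, H2⟩ := H ε hε (hεle.trans (min_le_left _ _))
  refine ⟨β₀, hβ₀, fun β hβ hβle N _ hN => ?_⟩
  obtain ⟨δV, hδV, hint⟩ := H2 β hβ hβle N hN
  have hline : 2 * 10 ^ 9 * Real.sqrt (Fintype.card n) * (L : ℝ) ^ 6 * ε ≤ 1 := by
    have h1 : ε ≤ 1 / (2 * 10 ^ 9 * Real.sqrt (Fintype.card n) * (L : ℝ) ^ 6) := hεle.trans (min_le_right _ _)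
    rw [le_div_iff₀ hc0] at h1; linarith only [h1]
  exact ⟨δV, hδV, hminE_of_interior_exists_d4 (L := L) hL hN hε.le hline hint⟩

end

end Summit.QuantumFields.BalabanUV.T4Continuum.NE7InteriorExistsGeneric
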